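import Mathlib.Analysis.Calculus.LogDerivUniformlyOn
import Mathlib.Analysis.Normed.Module.MultipliableUniformlyOn
import Literature.Analysis.Complex.HadamardGenusZeroProofs
import Literature.Analysis.TotalPositivity.PolyaFrequency
import Literature.NumberTheory.LFunctions.ZetaLogDerivSeries
import Literature.Analysis.Complex.FourierPolyaKiKimEngine
import HarnessLib

/-!
# The Gauss–Lucas theorem for entire functions of genus zero

Topic `Literature/Analysis/Complex`. Everything here is PROVED (standard axioms).
For a POLYNOMIAL the zeros of the derivative lie in the convex hull of the zeros (Gauss–Lucas; tree,
polynomial case: `Literature.NumberTheory.LFunctions.mem_of_aeval_derivative_eq_zero`). The same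
argument — `f'/f (z) = Σₙ 1/(z - zₙ)` and `Re (ū/(z - zₙ)) = Re (u (z - zₙ))/|z - zₙ|² > 0` when the
line `Re (u ·) = const` separates `z` from every zero — works verbatim for a transcendental entire
function of GENUS ZERO, whose Hadamard product `f(z) = f(0) ∏ₙ (1 - z/zₙ)` has no exponential factor
(the computation in the proof of Laguerre's theorem [Boas, *Entire Functions*, Thm. 2.8.1], with the
real part in place of the imaginary part; it fails for genus `≥ 1`). For `F` entire of order `< 1`
(tree `IsEntireOfOrderLtOne`; genus `0` by the tree's PROVED `hadamard_genus_zero_zeros`):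
* `logDeriv_eq_tsum_of_hasProd_one_sub_mul` — `F'/F (x) = Σₙ -bₙ/(1 - bₙ x)` off the zeros, for any
  Hadamard data `F z / F 0 = ∏ₙ (1 - bₙ z)`, `Σ ‖bₙ‖ < ∞` (Mathlib `logDeriv_tprod_eq_tsum`; the
  tree's `XiProduct.logDeriv_xiSq` in `ZetaLogDerivSeries.lean` is the case `F = ξ₁`, and its
  plumbing lemma `hasProd_zero_of_eq_zero` is reused);
* `deriv_ne_zero_of_forall_zero_re_mul_sub_pos` (`'` without `F 0 ≠ 0`) — **Gauss–Lucas, genus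
  `0`**: `F` not constant and `0 < Re (u (x - a))` for every zero `a` ⇒ `F' x ≠ 0`;
* `re_mul_lt/le_of_deriv_eq_zero` (`'`), `re_mul_le_of_iteratedDeriv_eq_zero` — the zeros of `F'`,
  and of every `F⁽ᵏ⁾`, lie in every open / closed half-plane containing the zeros of `F`.
Used for `ξ₁ = xiSq` in `Theorems/JensenPolynomialsLogBandXiDerivRightHalfPlane`. AI-produced
formalisation (prover-rh-jensen-eng-2-g5-0, 2026-08-27); AI review is weaker than expert review.

## References
* R. P. Boas, *Entire Functions*, Academic Press 1954, §2.8 Thm. 2.8.1 (Laguerre's theorem; the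
  proof computes `f'/f = k/z + Σ (z - zₙ)⁻¹` in genus `0`), §2.4 (order of the derivative).
* M. Marden, *Geometry of Polynomials*, AMS 1966, §6 Thm. (6,1); J. B. Conway, *Functions of One
  Complex Variable I*, GTM 11, Ch. XI Thm. 3.4 (Hadamard).
-/


noncomputable section

open Complex Filter Topology Set

namespace Literature.Analysis.Complex

open Literature.Analysis.TotalPositivity

/-! ## The logarithmic derivative of a genus-zero Hadamard product -/

/-- If `F z / F 0 = ∏ (1 - bₙ z)` and `F x ≠ 0`, `F 0 ≠ 0`, then no factor `1 - bₙ x` vanishes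
(the `bₙ ≠ 0` are inverses of zeros of `F`). [cite: Conway1978, Ch. XI Thm. 3.4] -/
theorem one_sub_mul_ne_zero_of_hasProd {F : ℂ → ℂ} {b : ℕ → ℂ}
    (hprod : ∀ z : ℂ, HasProd (fun n ↦ 1 - b n * z) (F z / F 0)) (h0 : F 0 ≠ 0) {x : ℂ}
    (hx : F x ≠ 0) (n : ℕ) : 1 - b n * x ≠ 0 := by
  intro h
  have := Literature.NumberTheory.LFunctions.hasProd_zero_of_eq_zero (hprod x) h
  rcases div_eq_zero_iff.1 this with h' | h'
  · exact hx h'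
  · exact h0 h'

/-- If `F z / F 0 = ∏ (1 - bₙ z)` with `F 0 ≠ 0` and `bₙ ≠ 0`, then `bₙ⁻¹` is a zero of `F`.
[cite: Conway1978, Ch. XI Thm. 3.4] -/
theorem eq_zero_inv_of_hasProd {F : ℂ → ℂ} {b : ℕ → ℂ}
    (hprod : ∀ z : ℂ, HasProd (fun n ↦ 1 - b n * z) (F z / F 0)) (h0 : F 0 ≠ 0) {n : ℕ}
    (hn : b n ≠ 0) : F (b n)⁻¹ = 0 := by
  have h := Literature.NumberTheory.LFunctions.hasProd_zero_of_eq_zero (hprod (b n)⁻¹) (n := n)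
    (by field_simp; ring)
  rcases div_eq_zero_iff.1 h with h | h
  · exact h
  · exact absurd h h0

/-- The log-derivative terms `-bₙ/(1 - bₙ x)` are absolutely summable when `Σ ‖bₙ‖ < ∞`
(eventually `‖1 - bₙ x‖ ≥ ½`): the series `Σ (z - zₙ)⁻¹` of a genus-zero product converges
absolutely off the zeros. [cite: Boas1954, §2.8 Thm. 2.8.1 (proof)] -/
theorem summable_norm_logDeriv_terms {b : ℕ → ℂ} (hb : Summable fun n ↦ ‖b n‖) (x : ℂ) :
    Summable fun n ↦ ‖-b n / (1 - b n * x)‖ := by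
  have hb0 : Tendsto (fun n ↦ b n) atTop (𝓝 0) := by
    have := hb.tendsto_atTop_zero
    exact tendsto_zero_iff_norm_tendsto_zero.2 this
  have hev : ∀ᶠ n in atTop, ‖b n * x‖ ≤ 1 / 2 := by
    have : Tendsto (fun n ↦ b n * x) atTop (𝓝 0) := by simpa using hb0.mul_const x
    have := (tendsto_zero_iff_norm_tendsto_zero.1 this)
    exact (this.eventually (ge_mem_nhds (by norm_num : (0 : ℝ) < 1 / 2)))
  refine Summable.of_norm_bounded_eventually (g := fun n ↦ 2 * ‖b n‖) (hb.mul_left 2) ?_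
  rw [Nat.cofinite_eq_atTop]
  filter_upwards [hev] with n hn
  rw [norm_norm, norm_div, norm_neg]
  have h1 : 1 / 2 ≤ ‖1 - b n * x‖ := by
    have := norm_sub_norm_le (1 : ℂ) (b n * x)
    rw [norm_one] at this
    linarith
  rw [div_le_iff₀ (by linarith)]
  nlinarith [norm_nonneg (b n)]

/-- **Logarithmic derivative of a genus-zero Hadamard product.** If `F` is entire, `F 0 ≠ 0`,
`Σ ‖bₙ‖ < ∞` and `F z / F 0 = ∏ₙ (1 - bₙ z)` for all `z`, then at every `x` with `F x ≠ 0`,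
`F'(x)/F(x) = Σₙ -bₙ/(1 - bₙ x)` (`= Σ' 1/(x - aₙ)` over the zeros `aₙ = bₙ⁻¹`). Mathlib's
`logDeriv_tprod_eq_tsum` on the disc `‖z‖ < ‖x‖ + 1`, where the product converges locally uniformly.
[cite: Boas1954, §2.8 proof of Thm. 2.8.1] [cite: Conway1978, Ch. XI Thm. 3.4] -/
theorem logDeriv_eq_tsum_of_hasProd_one_sub_mul {F : ℂ → ℂ}
    (h0 : F 0 ≠ 0) {b : ℕ → ℂ} (hb : Summable fun n ↦ ‖b n‖)
    (hprod : ∀ z : ℂ, HasProd (fun n ↦ 1 - b n * z) (F z / F 0)) {x : ℂ} (hx : F x ≠ 0) :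
    logDeriv F x = ∑' n, -b n / (1 - b n * x) := by
  set K : Set ℂ := Metric.ball 0 (‖x‖ + 1) with hK
  have hKo : IsOpen K := Metric.isOpen_ball
  have hxK : x ∈ K := by simp [hK]
  set f : ℕ → ℂ → ℂ := fun n z ↦ -(b n * z) with hf
  -- the product in the `1 + f n z` form is `(F 0)⁻¹ * F`
  have hprod_fun : (fun z ↦ ∏' n, (1 + f n z)) = fun z ↦ (F 0)⁻¹ * F z := by
    funext z
    have := (hprod z).tprod_eq
    simp only [hf, ← sub_eq_add_neg]
    rw [this]; field_simp
  have hmult : MultipliableLocallyUniformlyOn (fun n z ↦ 1 + f n z) K := by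
    refine Summable.multipliableLocallyUniformlyOn_nat_one_add hKo
      (u := fun n ↦ ‖b n‖ * (‖x‖ + 1)) (hb.mul_right _) (Eventually.of_forall fun n z hz ↦ ?_)
      fun n ↦ by fun_prop
    simp only [hf, norm_neg, norm_mul]
    have : ‖z‖ ≤ ‖x‖ + 1 := by
      simp only [hK, Metric.mem_ball, dist_zero_right] at hz; exact hz.le
    gcongr
  have hlog : ∀ n, logDeriv (fun z ↦ 1 + f n z) x = -b n / (1 - b n * x) := by
    intro n
    rw [logDeriv_apply]
    have hd : HasDerivAt (fun z ↦ 1 + f n z) (-(b n * 1)) x := by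
      simpa [hf] using ((hasDerivAt_id x).const_mul (b n)).neg.const_add 1
    rw [hd.deriv]
    simp only [hf, mul_one]
    ring
  have h := logDeriv_tprod_eq_tsum hKo hxK (f := fun n z ↦ 1 + f n z)
    (fun n ↦ by
      simpa [hf, sub_eq_add_neg] using one_sub_mul_ne_zero_of_hasProd hprod h0 hx n)
    (fun n ↦ by fun_prop)
    (by simpa only [hlog] using (summable_norm_logDeriv_terms hb x).of_norm)
    hmult
    (by
      have := congrFun hprod_fun x
      rw [this]
      exact mul_ne_zero (inv_ne_zero h0) hx)
  simp only [hlog] at h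
  rw [hprod_fun, logDeriv_const_mul x _ (inv_ne_zero h0)] at h
  exact h

/-! ## Gauss–Lucas in genus zero -/

/-- The term attached to `bₙ`: `Re (ū · (-bₙ/(1 - bₙ x))) = Re (u (x - bₙ⁻¹)) / ‖x - bₙ⁻¹‖²` for
`bₙ ≠ 0` (and `0` for `bₙ = 0`). [cite: Boas1954, §2.8 proof of Thm. 2.8.1] -/
theorem re_conj_mul_logDeriv_term {b x u : ℂ} (hb : b ≠ 0) (hx : 1 - b * x ≠ 0) :
    ((starRingEnd ℂ) u * (-b / (1 - b * x))).re = (u * (x - b⁻¹)).re / ‖x - b⁻¹‖ ^ 2 := by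
  have hxa : x - b⁻¹ ≠ 0 := by
    intro h
    apply hx
    have : x = b⁻¹ := sub_eq_zero.1 h
    rw [this, mul_inv_cancel₀ hb, sub_self]
  have hterm : -b / (1 - b * x) = (x - b⁻¹)⁻¹ := by
    rw [inv_eq_one_div, div_eq_div_iff hx hxa]
    have : b * b⁻¹ = 1 := mul_inv_cancel₀ hb
    linear_combination this
  rw [hterm, Complex.inv_def, ← mul_assoc, Complex.re_mul_ofReal, normSq_eq_norm_sq]
  congr 1
  rw [← Complex.conj_re (u * (x - b⁻¹)), map_mul]

/-- **Gauss–Lucas theorem for entire functions of genus zero (core form).** Let `F` be entire of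
order `< 1` with `F 0 ≠ 0`, not constant (`F' w ≠ 0` somewhere), and let `x, u ∈ ℂ` be such that
`0 < Re (u (x - a))` for every zero `a` of `F` (the line `Re (u ·) = Re (u x)` separates `x` from all
the zeros). Then `F' x ≠ 0`. Proof: `F'/F (x) = Σ' 1/(x - aₙ)` over the zeros with multiplicity
(genus-zero Hadamard product, no exponential factor) and `Re (ū/(x - aₙ)) = Re (u(x - aₙ))/|x - aₙ|² > 0`
for every term; there is at least one zero since `F` is not constant.
[cite: Boas1954, §2.8 Thm. 2.8.1 (proof)] [cite: Marden1966, §6 Thm. (6,1)] -/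
theorem deriv_ne_zero_of_forall_zero_re_mul_sub_pos {F : ℂ → ℂ} (hF : IsEntireOfOrderLtOne F)
    (h0 : F 0 ≠ 0) (hnc : ∃ w : ℂ, deriv F w ≠ 0) {u x : ℂ}
    (hsep : ∀ a : ℂ, F a = 0 → 0 < (u * (x - a)).re) : deriv F x ≠ 0 := by
  classical
  obtain ⟨hdiff, ρ, C, hρ, hbound⟩ := hF
  obtain ⟨b, hb, hbzero, -, hprod⟩ := hadamard_genus_zero_zeros F ρ C hdiff hρ hbound h0
  -- `x` is not a zero of `F`
  have hx : F x ≠ 0 := fun h ↦ by simpa using hsep x h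
  -- not all `bₙ` vanish (else `F` is constant)
  have hex : ∃ n, b n ≠ 0 := by
    by_contra hall
    push Not at hall
    obtain ⟨w, hw⟩ := hnc
    have hconst : ∀ z, F z = F 0 := fun z ↦ by
      have h1 := (hprod z).tprod_eq
      have h2 : ∏' n, (1 - b n * z) = 1 := by simp [hall]
      rw [h2] at h1
      field_simp at h1
      exact h1.symm
    have : F = fun _ ↦ F 0 := funext hconst
    apply hw
    rw [this, deriv_const]
  obtain ⟨n₀, hn₀⟩ := hex
  -- the log-derivative series and its real parts against `ū`
  have hL := logDeriv_eq_tsum_of_hasProd_one_sub_mul h0 hb hprod hx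
  have hsum : HasSum (fun n ↦ -b n / (1 - b n * x)) (logDeriv F x) := by
    rw [hL]; exact (summable_norm_logDeriv_terms hb x).of_norm.hasSum
  have hsumRe : HasSum (fun n ↦ ((starRingEnd ℂ) u * (-b n / (1 - b n * x))).re)
      ((starRingEnd ℂ) u * logDeriv F x).re :=
    Complex.hasSum_re (hsum.mul_left _)
  have hfac : ∀ n, 1 - b n * x ≠ 0 := one_sub_mul_ne_zero_of_hasProd hprod h0 hx
  -- every term is `≥ 0`, the `n₀`-th is `> 0`
  have hterm_nonneg : ∀ n, 0 ≤ ((starRingEnd ℂ) u * (-b n / (1 - b n * x))).re := fun n ↦ by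
    by_cases hbn : b n = 0
    · simp [hbn]
    · rw [re_conj_mul_logDeriv_term hbn (hfac n)]
      exact div_nonneg (hsep _ (hbzero n hbn)).le (sq_nonneg _)
  have hterm_pos : 0 < ((starRingEnd ℂ) u * (-b n₀ / (1 - b n₀ * x))).re := by
    rw [re_conj_mul_logDeriv_term hn₀ (hfac n₀)]
    refine div_pos (hsep _ (hbzero n₀ hn₀)) (pow_pos (norm_pos_iff.2 ?_) 2)
    intro h
    have : F x = 0 := by rw [sub_eq_zero.1 h]; exact hbzero n₀ hn₀
    exact hx this
  have hge := sum_le_hasSum {n₀} (fun n _ ↦ hterm_nonneg n) hsumRe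
  rw [Finset.sum_singleton] at hge
  have hpos : 0 < ((starRingEnd ℂ) u * logDeriv F x).re := lt_of_lt_of_le hterm_pos hge
  -- conclude
  intro hd
  rw [logDeriv_apply, hd, zero_div, mul_zero, Complex.zero_re] at hpos
  exact lt_irrefl _ hpos

/-- **Gauss–Lucas, genus zero, open half-plane:** if every zero `a` of `F` satisfies
`Re (u a) < c`, then so does every zero of `F'` (`F` entire of order `< 1`, `F 0 ≠ 0`, not constant).
[cite: Boas1954, §2.8 Thm. 2.8.1 (proof)] [cite: Marden1966, §6 Thm. (6,1)] -/
theorem re_mul_lt_of_deriv_eq_zero {F : ℂ → ℂ} (hF : IsEntireOfOrderLtOne F) (h0 : F 0 ≠ 0)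
    (hnc : ∃ w : ℂ, deriv F w ≠ 0) {u : ℂ} {c : ℝ} (hzero : ∀ a : ℂ, F a = 0 → (u * a).re < c)
    {x : ℂ} (hx : deriv F x = 0) : (u * x).re < c := by
  by_contra hcx
  push Not at hcx
  refine deriv_ne_zero_of_forall_zero_re_mul_sub_pos hF h0 hnc (u := u) (fun a ha ↦ ?_) hx
  have := hzero a ha
  rw [mul_sub, Complex.sub_re]
  linarith

/-- **Gauss–Lucas, genus zero, closed half-plane:** if every zero `a` of `F` satisfies
`Re (u a) ≤ c`, then so does every zero of `F'` (`F` entire of order `< 1`, `F 0 ≠ 0`, not constant).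
Intersecting over all such half-planes: the zeros of `F'` lie in the closed convex hull of the zeros
of `F`. [cite: Boas1954, §2.8 Thm. 2.8.1 (proof)] [cite: Marden1966, §6 Thm. (6,1)] -/
theorem re_mul_le_of_deriv_eq_zero {F : ℂ → ℂ} (hF : IsEntireOfOrderLtOne F) (h0 : F 0 ≠ 0)
    (hnc : ∃ w : ℂ, deriv F w ≠ 0) {u : ℂ} {c : ℝ} (hzero : ∀ a : ℂ, F a = 0 → (u * a).re ≤ c)
    {x : ℂ} (hx : deriv F x = 0) : (u * x).re ≤ c := by
  by_contra hcx
  push Not at hcx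
  refine deriv_ne_zero_of_forall_zero_re_mul_sub_pos hF h0 hnc (u := u) (fun a ha ↦ ?_) hx
  have := hzero a ha
  rw [mul_sub, Complex.sub_re]
  linarith

/-- The case `u = 1`, `c = 0` used by the cell rh-jensen: if all zeros of `F` have negative real
part then so do all zeros of `F'`. [cite: Boas1954, §2.8 Thm. 2.8.1 (proof)] -/
theorem re_neg_of_deriv_eq_zero {F : ℂ → ℂ} (hF : IsEntireOfOrderLtOne F) (h0 : F 0 ≠ 0)
    (hnc : ∃ w : ℂ, deriv F w ≠ 0) (hzero : ∀ a : ℂ, F a = 0 → a.re < 0)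
    {x : ℂ} (hx : deriv F x = 0) : x.re < 0 := by
  have h := re_mul_lt_of_deriv_eq_zero hF h0 hnc (u := 1) (c := 0)
    (fun a ha ↦ by simpa using hzero a ha) hx
  simpa using h

/-! ## Appendix (2026-08-27): no hypothesis at the origin (translate the argument,
`IsEntireOfOrderLtOne.comp_add_const`), and all derivatives (`IsEntireOfOrderLtOne.iteratedDeriv_of`:
every derivative of an entire function of order `< 1` is of order `< 1`). -/

/-- Growth normalisation into `½ ≤ σ < 1`, `C' ≥ 1` (the tree's `HadamardGenusZero.growth_normalise`
recording in addition `½ ≤ σ`). [cite: Conway1978, Ch. XI Thm. 3.4] -/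
theorem growth_normalise_half {F : ℂ → ℂ} (hF : Differentiable ℂ F) {ρ C : ℝ} (hρ : ρ < 1)
    (hb : ∀ z : ℂ, ‖F z‖ ≤ C * Real.exp (‖z‖ ^ ρ)) :
    ∃ σ C' : ℝ, 1 / 2 ≤ σ ∧ σ < 1 ∧ 1 ≤ C' ∧ ∀ z : ℂ, ‖F z‖ ≤ C' * Real.exp (‖z‖ ^ σ) := by
  obtain ⟨M₀, hM₀⟩ := (isCompact_closedBall (0 : ℂ) 1).exists_bound_of_continuousOn
    hF.continuous.continuousOn
  refine ⟨max ρ (1 / 2), max (max |C| 1) M₀, le_max_right _ _, max_lt hρ (by norm_num),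
    le_trans (le_max_right _ _) (le_max_left _ _), fun z => ?_⟩
  by_cases hz : ‖z‖ ≤ 1
  · calc ‖F z‖ ≤ M₀ := hM₀ z (Metric.mem_closedBall.2 (by simpa using hz))
      _ ≤ M₀ * Real.exp (‖z‖ ^ max ρ (1 / 2)) := by
          have hM : 0 ≤ M₀ := (norm_nonneg _).trans (hM₀ 0 (by simp))
          have : 1 ≤ Real.exp (‖z‖ ^ max ρ (1 / 2)) := Real.one_le_exp (by positivity)
          nlinarith
      _ ≤ max (max |C| 1) M₀ * Real.exp (‖z‖ ^ max ρ (1 / 2)) := by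
          gcongr; exact le_max_right _ _
  · rw [not_le] at hz
    calc ‖F z‖ ≤ C * Real.exp (‖z‖ ^ ρ) := hb z
      _ ≤ |C| * Real.exp (‖z‖ ^ ρ) := by gcongr; exact le_abs_self C
      _ ≤ |C| * Real.exp (‖z‖ ^ max ρ (1 / 2)) := by
          apply mul_le_mul_of_nonneg_left _ (abs_nonneg C)
          exact Real.exp_le_exp.mpr (Real.rpow_le_rpow_of_exponent_le hz.le (le_max_left _ _))
      _ ≤ max (max |C| 1) M₀ * Real.exp (‖z‖ ^ max ρ (1 / 2)) := by
          gcongr; exact le_trans (le_max_left _ _) (le_max_left _ _)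

/-- **Entire of order `< 1` is translation invariant**: if `‖F z‖ ≤ C e^{‖z‖^ρ}` (`ρ < 1`) then
`z ↦ F (z + c)` satisfies a bound of the same shape (`(‖z‖ + ‖c‖)^σ ≤ ‖z‖^σ + ‖c‖^σ` for
`0 ≤ σ ≤ 1`). [cite: Boas1954, §2.1 (order is unchanged by translation)] -/
theorem _root_.Literature.Analysis.TotalPositivity.IsEntireOfOrderLtOne.comp_add_const {F : ℂ → ℂ}
    (hF : IsEntireOfOrderLtOne F) (c : ℂ) : IsEntireOfOrderLtOne (fun z ↦ F (z + c)) := by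
  obtain ⟨hdiff, ρ, C, hρ, hb⟩ := hF
  obtain ⟨σ, C', hσ0, hσ1, hC', hb'⟩ := growth_normalise_half hdiff hρ hb
  have hσ0' : 0 ≤ σ := by linarith
  refine ⟨hdiff.comp (differentiable_id.add_const c), σ, C' * Real.exp (‖c‖ ^ σ), hσ1, fun z ↦ ?_⟩
  have hpow : ‖z + c‖ ^ σ ≤ ‖z‖ ^ σ + ‖c‖ ^ σ :=
    calc ‖z + c‖ ^ σ ≤ (‖z‖ + ‖c‖) ^ σ :=
          Real.rpow_le_rpow (norm_nonneg _) (norm_add_le _ _) hσ0'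
      _ ≤ ‖z‖ ^ σ + ‖c‖ ^ σ :=
          Real.rpow_add_le_add_rpow (norm_nonneg _) (norm_nonneg _) hσ0' hσ1.le
  calc ‖F (z + c)‖ ≤ C' * Real.exp (‖z + c‖ ^ σ) := hb' _
    _ ≤ C' * Real.exp (‖z‖ ^ σ + ‖c‖ ^ σ) := by
        have hC0 : 0 ≤ C' := by linarith
        gcongr
    _ = C' * Real.exp (‖c‖ ^ σ) * Real.exp (‖z‖ ^ σ) := by rw [Real.exp_add]; ring

/-- **Every derivative of an entire function of order `< 1` is entire of order `< 1`** (same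
exponent after normalisation; Cauchy's estimate on unit circles, tree
`KiKim.exists_growth_iteratedDeriv_of_lt_one`). [cite: Boas1954, §2.4 Thm. 2.4.1 (f and f' have the same order)] -/
theorem _root_.Literature.Analysis.TotalPositivity.IsEntireOfOrderLtOne.iteratedDeriv_of {F : ℂ → ℂ}
    (hF : IsEntireOfOrderLtOne F) (n : ℕ) : IsEntireOfOrderLtOne (iteratedDeriv n F) := by
  obtain ⟨hdiff, ρ, C, hρ, hb⟩ := hF
  obtain ⟨σ, C', hσ0, hσ1, hC', hb'⟩ := growth_normalise_half hdiff hρ hb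
  obtain ⟨C'', -, hb''⟩ := KiKim.exists_growth_iteratedDeriv_of_lt_one hdiff (by linarith) hσ1
    (by linarith) hb' n
  exact ⟨TotalPositivity.differentiable_iteratedDeriv hdiff n, σ, C'', hσ1, hb''⟩

/-- **Gauss–Lucas theorem for entire functions of genus zero (core form, no hypothesis at `0`).**
If `F` is entire of order `< 1`, not constant (`F' w ≠ 0` somewhere), and `0 < Re (u (x - a))` for
every zero `a` of `F`, then `F' x ≠ 0`. (Translate: `G z = F (z + x)` has `G 0 = F x ≠ 0`.)
[cite: Boas1954, §2.8 Thm. 2.8.1 (proof)] [cite: Marden1966, §6 Thm. (6,1)] -/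
theorem deriv_ne_zero_of_forall_zero_re_mul_sub_pos' {F : ℂ → ℂ} (hF : IsEntireOfOrderLtOne F)
    (hnc : ∃ w : ℂ, deriv F w ≠ 0) {u x : ℂ}
    (hsep : ∀ a : ℂ, F a = 0 → 0 < (u * (x - a)).re) : deriv F x ≠ 0 := by
  have hx : F x ≠ 0 := fun h ↦ by simpa using hsep x h
  set G : ℂ → ℂ := fun z ↦ F (z + x) with hG
  have hGe : IsEntireOfOrderLtOne G := hF.comp_add_const x
  have hG0 : G 0 ≠ 0 := by simpa [hG] using hx
  have hderiv : ∀ z, deriv G z = deriv F (z + x) := fun z ↦ deriv_comp_add_const F x z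
  have hGnc : ∃ w : ℂ, deriv G w ≠ 0 := by
    obtain ⟨w, hw⟩ := hnc
    exact ⟨w - x, by rwa [hderiv, sub_add_cancel]⟩
  have hGsep : ∀ a : ℂ, G a = 0 → 0 < (u * (0 - a)).re := fun a ha ↦ by
    have := hsep (a + x) ha
    simpa [mul_sub, mul_add] using this
  have h := deriv_ne_zero_of_forall_zero_re_mul_sub_pos hGe hG0 hGnc hGsep
  rwa [hderiv, zero_add] at h

/-- Open half-plane form without the hypothesis at `0`.
[cite: Boas1954, §2.8 Thm. 2.8.1 (proof)] [cite: Marden1966, §6 Thm. (6,1)] -/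
theorem re_mul_lt_of_deriv_eq_zero' {F : ℂ → ℂ} (hF : IsEntireOfOrderLtOne F)
    (hnc : ∃ w : ℂ, deriv F w ≠ 0) {u : ℂ} {c : ℝ} (hzero : ∀ a : ℂ, F a = 0 → (u * a).re < c)
    {x : ℂ} (hx : deriv F x = 0) : (u * x).re < c := by
  by_contra hcx
  push Not at hcx
  refine deriv_ne_zero_of_forall_zero_re_mul_sub_pos' hF hnc (u := u) (fun a ha ↦ ?_) hx
  have := hzero a ha
  rw [mul_sub, Complex.sub_re]
  linarith

/-- Closed half-plane form without the hypothesis at `0` (so: the zeros of `F'` lie in the closed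
convex hull of the zeros of `F`). [cite: Boas1954, §2.8 Thm. 2.8.1 (proof)] [cite: Marden1966, §6 Thm. (6,1)] -/
theorem re_mul_le_of_deriv_eq_zero' {F : ℂ → ℂ} (hF : IsEntireOfOrderLtOne F)
    (hnc : ∃ w : ℂ, deriv F w ≠ 0) {u : ℂ} {c : ℝ} (hzero : ∀ a : ℂ, F a = 0 → (u * a).re ≤ c)
    {x : ℂ} (hx : deriv F x = 0) : (u * x).re ≤ c := by
  by_contra hcx
  push Not at hcx
  refine deriv_ne_zero_of_forall_zero_re_mul_sub_pos' hF hnc (u := u) (fun a ha ↦ ?_) hx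
  have := hzero a ha
  rw [mul_sub, Complex.sub_re]
  linarith

/-- **All derivatives.** If `F` is entire of order `< 1` and `F⁽ⁿ⁺¹⁾ ≢ 0`, then for every
`k ≤ n + 1` the zeros of `F⁽ᵏ⁾` lie in every closed half-plane `{Re (u z) ≤ c}` containing the zeros
of `F` (induction on `k`; each `F⁽ᵏ⁾` is of order `< 1` and not constant).
[cite: Boas1954, §2.8 Thm. 2.8.1 (proof)] [cite: Marden1966, §6 Thm. (6,1)] -/
theorem re_mul_le_of_iteratedDeriv_eq_zero {F : ℂ → ℂ} (hF : IsEntireOfOrderLtOne F) {n : ℕ}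
    (hnc : ∃ w : ℂ, iteratedDeriv (n + 1) F w ≠ 0) {u : ℂ} {c : ℝ}
    (hzero : ∀ a : ℂ, F a = 0 → (u * a).re ≤ c) {k : ℕ} (hk : k ≤ n + 1) {x : ℂ}
    (hx : iteratedDeriv k F x = 0) : (u * x).re ≤ c := by
  induction k generalizing x with
  | zero =>
    rw [iteratedDeriv_zero] at hx
    exact hzero x hx
  | succ k ih =>
    rw [iteratedDeriv_succ] at hx
    have hk' : k ≤ n + 1 := Nat.le_of_succ_le hk
    have hnck : ∃ w : ℂ, deriv (iteratedDeriv k F) w ≠ 0 := by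
      by_contra hall
      push Not at hall
      obtain ⟨w, hw⟩ := hnc
      apply hw
      have hzeroFun : iteratedDeriv (k + 1) F = 0 := by
        funext z; rw [iteratedDeriv_succ]; exact hall z
      have hcomp : iteratedDeriv (n + 1) F =
          iteratedDeriv (n + 1 - (k + 1)) (iteratedDeriv (k + 1) F) := by
        rw [iteratedDeriv_eq_iterate, iteratedDeriv_eq_iterate, iteratedDeriv_eq_iterate,
          ← Function.iterate_add_apply, Nat.sub_add_cancel hk]
      have hzero' : ∀ m : ℕ, iteratedDeriv m (0 : ℂ → ℂ) = 0 := fun m ↦ by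
        induction m with
        | zero => simp
        | succ m ihm => rw [iteratedDeriv_succ, ihm]; funext z; simp
      rw [hcomp, hzeroFun, hzero']
      rfl
    exact re_mul_le_of_deriv_eq_zero' (hF.iteratedDeriv_of k) hnck (fun a ha ↦ ih hk' ha) hx

end Literature.Analysis.Complex
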